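import Summits.CriticalPhenomena.PercolationContinuityZ3.Theorems.PercNearOneGluingNoHeavyLowerTailAntipodalR1Adjacent
import HarnessLib

/-!
# Reimer certificates: the class form of the butterfly lemma, and its specialisation to ANTI₁

Support file for `stmt-CriticalPhenomena-4575` (memos `prim-gen-kcluster/KCLUSTER-gen73.md` §1 and
`KCLUSTER-gen74.md` §2; conjecture ANTI₁ of `KCLUSTER-gen52.md` §3).  No definitions, no named facts,
no sorries.

The "Reimer route" to the weight-free counting statement ANTI₁ (`#L ≤ #R(b,c)`, vocabulary of
`AntipodalR1`: `lSet`, `rSet`) reduces the inequality for an instance to the existence of a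
*certificate assignment*: every point `x` of the left-hand family gets a class `cls x`, a flip set
`T x` and (through its class) a target side `tgt (cls x)`; writing `Z(x₁,x₂)` for the *cylinder* of an
ordered pair of class-mates — the colourings `z` with `z = x₁` off `T x₁` and `z = x̄₂` on `T x₂` — one
requires

* (F) every cylinder of a class, normalised by the class target (the identity for target `true`, the
  coordinatewise flip `z ↦ z̄` for target `false`), lies in `R`, and
* (D) the normalised cylinders of distinct classes are disjoint.

**Theorem** (`ReimerCertificate.card_le_of_certificate`, abstract form on the cube `α → Bool`): (F) and
(D) imply `#L ≤ #R`.  Proof: per class `X_k`, Reimer's butterfly lemma in flock form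
(`Literature.Probability.Percolation.reimer_butterfly_card_le`, [cite: ReimerCPC2000, Thm. 1.2], in the
flock form of Borgs–Chayes–Randall 1999, §§4–5) with red wings `[x]_{(T x)ᶜ}` and flipped yellow wings
`{z = x̄ on T x}` gives `#X_k ≤ #I_k`, where `I_k` is the union of the cylinders of the class;
normalising by the target is injective, lands in `R` by (F), and the normalised images are pairwise
disjoint by (D); summing over classes gives the claim.  No injectivity of `x ↦ x △ T x` is needed
anywhere: collisions inside a class are absorbed by Reimer's lemma.  The single-class case with
target `true` (`card_le_of_oneClass`) is the flip lemma with per-point witnesses.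
`AntipodalR1.card_lSet_le_of_certificate` is the specialisation to ANTI₁ with the targets `R(b,c)`
(side `true`) and `R(c,b)` (side `false`); the coordinatewise flip exchanges them
(`AntipodalR1.flip_mem_rSet_iff`).
-/

namespace Summit.CriticalPhenomena.PercolationContinuityZ3.Theorems

namespace ReimerCertificate

open Finset

variable {α : Type*}

/-- Normalisation by a target side is injective: `z ↦ z` for `true`, `z ↦ z̄` for `false`. [this work] -/
theorem norm_injective (t : Bool) :
    Function.Injective (fun z : α → Bool => if t then z else fun i => !z i) := by
  intro z z' h
  cases t with
  | true => simpa using h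
  | false =>
    funext i
    have := congrFun (by simpa using h) i
    simpa using this

variable [Fintype α] [DecidableEq α]

/-- **Reimer certificates prove the counting inequality** (class form of Reimer's butterfly lemma).
Let `L, R` be finite families of points of the cube `α → Bool`; let every `x` carry a class `cls x` and
a flip set `T x`, and every class `k` a target side `tgt k`.  If (F) every point `z` of a cylinder
`Z(x₁,x₂)` of two class-mates (`z = x₁` off `T x₁`, `z = x̄₂` on `T x₂`), normalised by the class target,
lies in `R`, and (D) normalised cylinder points of different classes never coincide, then `#L ≤ #R`.
[this work; engine: `reimer_butterfly_card_le`, cite: ReimerCPC2000, Thm. 1.2] -/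
theorem card_le_of_certificate {κ : Type*} [DecidableEq κ]
    (L R : Finset (α → Bool)) (cls : (α → Bool) → κ) (T : (α → Bool) → Finset α) (tgt : κ → Bool)
    (hF : ∀ x₁ ∈ L, ∀ x₂ ∈ L, cls x₁ = cls x₂ → ∀ z : α → Bool, (∀ i, i ∉ T x₁ → z i = x₁ i) →
      (∀ i ∈ T x₂, z i = !x₂ i) → (if tgt (cls x₁) then z else fun i => !z i) ∈ R)
    (hD : ∀ x₁ ∈ L, ∀ x₂ ∈ L, ∀ x₃ ∈ L, ∀ x₄ ∈ L, cls x₁ = cls x₂ → cls x₃ = cls x₄ → cls x₁ ≠ cls x₃ →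
      ∀ z z' : α → Bool, (∀ i, i ∉ T x₁ → z i = x₁ i) → (∀ i ∈ T x₂, z i = !x₂ i) →
      (∀ i, i ∉ T x₃ → z' i = x₃ i) → (∀ i ∈ T x₄, z' i = !x₄ i) →
      (if tgt (cls x₁) then z else fun i => !z i) ≠ (if tgt (cls x₃) then z' else fun i => !z' i)) :
    L.card ≤ R.card := by
  classical
  -- the classes, the class members, the class images and their normalisations
  set K : Finset κ := L.image cls with hK
  let X : κ → Finset (α → Bool) := fun k => L.filter fun x => cls x = k
  let I : κ → Finset (α → Bool) := fun k =>
    ((X k).biUnion fun x => univ.filter fun z : α → Bool => ∀ i ∈ (univ \ T x), z i = x i) ∩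
    ((X k).biUnion fun x => univ.filter fun z : α → Bool => ∀ i, i ∉ (univ \ T x) → z i = !x i)
  let nrm : Bool → (α → Bool) → (α → Bool) := fun t z => if t then z else fun i => !z i
  let J : κ → Finset (α → Bool) := fun k => (I k).image (nrm (tgt k))
  have hX : ∀ k x, x ∈ X k ↔ x ∈ L ∧ cls x = k := fun k x => by simp [X]
  -- Reimer's butterfly lemma, one flock per class
  have hI : ∀ k, (X k).card ≤ (I k).card := fun k =>
    Literature.Probability.Percolation.reimer_butterfly_card_le (X k) (fun x => univ \ T x)
  -- points of a class image are cylinder points of two class-mates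
  have hIcyl : ∀ k, ∀ z ∈ I k, ∃ x₁ ∈ L, ∃ x₂ ∈ L, cls x₁ = k ∧ cls x₂ = k ∧
      (∀ i, i ∉ T x₁ → z i = x₁ i) ∧ (∀ i ∈ T x₂, z i = !x₂ i) := by
    intro k z hz
    obtain ⟨hz1, hz2⟩ := mem_inter.1 hz
    obtain ⟨x₁, hx₁, hz₁⟩ := mem_biUnion.1 hz1
    obtain ⟨x₂, hx₂, hz₂⟩ := mem_biUnion.1 hz2
    have h₁ := (mem_filter.1 hz₁).2
    have h₂ := (mem_filter.1 hz₂).2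
    exact ⟨x₁, ((hX k x₁).1 hx₁).1, x₂, ((hX k x₂).1 hx₂).1, ((hX k x₁).1 hx₁).2, ((hX k x₂).1 hx₂).2,
      fun i hi => h₁ i (mem_sdiff.2 ⟨mem_univ i, hi⟩), fun i hi => h₂ i (fun h => (mem_sdiff.1 h).2 hi)⟩
  have hJcard : ∀ k, (J k).card = (I k).card := fun k =>
    card_image_of_injective _ (norm_injective (tgt k))
  have hJsub : ∀ k ∈ K, J k ⊆ R := by
    intro k _ w hw
    obtain ⟨z, hz, rfl⟩ := mem_image.1 hw
    obtain ⟨x₁, hx₁, x₂, hx₂, h₁, h₂, hc₁, hc₂⟩ := hIcyl k z hz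
    have := hF x₁ hx₁ x₂ hx₂ (h₁.trans h₂.symm) z hc₁ hc₂
    rwa [h₁] at this
  have hJdisj : ∀ k ∈ K, ∀ k' ∈ K, k ≠ k' → Disjoint (J k) (J k') := by
    intro k _ k' _ hkk'
    rw [Finset.disjoint_left]
    intro w hw hw'
    obtain ⟨z, hz, rfl⟩ := mem_image.1 hw
    obtain ⟨z', hz', hzz'⟩ := mem_image.1 hw'
    obtain ⟨x₁, hx₁, x₂, hx₂, h₁, h₂, hc₁, hc₂⟩ := hIcyl k z hz
    obtain ⟨x₃, hx₃, x₄, hx₄, h₃, h₄, hc₃, hc₄⟩ := hIcyl k' z' hz'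
    have hne : cls x₁ ≠ cls x₃ := by rw [h₁, h₃]; exact hkk'
    have := hD x₁ hx₁ x₂ hx₂ x₃ hx₃ x₄ hx₄ (h₁.trans h₂.symm) (h₃.trans h₄.symm) hne z z' hc₁ hc₂ hc₃ hc₄
    rw [h₁, h₃] at this
    exact this hzz'.symm
  calc L.card = ∑ k ∈ K, (X k).card := card_eq_sum_card_image cls L
    _ ≤ ∑ k ∈ K, (I k).card := sum_le_sum fun k _ => hI k
    _ = ∑ k ∈ K, (J k).card := sum_congr rfl fun k _ => (hJcard k).symm
    _ = (K.biUnion J).card := (card_biUnion hJdisj).symm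
    _ ≤ R.card := card_le_card (biUnion_subset.2 hJsub)

/-- **One class, one target** (the flip lemma with per-point witnesses): if every point of every
cylinder `Z(x₁,x₂)`, `x₁, x₂ ∈ L`, lies in `R`, then `#L ≤ #R`. [this work] -/
theorem card_le_of_oneClass (L R : Finset (α → Bool)) (T : (α → Bool) → Finset α)
    (hF : ∀ x₁ ∈ L, ∀ x₂ ∈ L, ∀ z : α → Bool, (∀ i, i ∉ T x₁ → z i = x₁ i) →
      (∀ i ∈ T x₂, z i = !x₂ i) → z ∈ R) : L.card ≤ R.card :=
  card_le_of_certificate L R (fun _ => ()) T (fun _ => true)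
    (fun x₁ h₁ x₂ h₂ _ z hz₁ hz₂ => by simpa using hF x₁ h₁ x₂ h₂ z hz₁ hz₂)
    (fun _ _ _ _ _ _ _ _ _ _ h => absurd rfl h)

end ReimerCertificate

/-! ### Specialisation to ANTI₁ -/

namespace AntipodalR1

open Finset

variable {V ι : Type*} [Fintype ι] [DecidableEq ι]

/-- The coordinatewise flip exchanges `R(c,b)` and `R(b,c)`. [this work] -/
theorem flip_mem_rSet_iff (ends : ι → Sym2 V) (a b c : V) (z : ι → Bool) :
    (fun i => !z i) ∈ rSet ends a b c ↔ z ∈ rSet ends a c b := by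
  classical
  simp only [rSet, mem_filter, mem_univ, true_and, mem_clus_flip, Bool.not_true, Bool.not_false]
  tauto

/-- Normalising a point of the target family of side `t` (`R(b,c)` for `true`, `R(c,b)` for `false`)
lands in `R(b,c)`. [this work] -/
theorem norm_mem_rSet (ends : ι → Sym2 V) (a b c : V) (t : Bool) {z : ι → Bool}
    (hz : z ∈ (if t then rSet ends a b c else rSet ends a c b)) :
    (if t then z else fun i => !z i) ∈ rSet ends a b c := by
  cases t with
  | false =>
    have hz' : z ∈ rSet ends a c b := by simpa using hz
    simpa using (flip_mem_rSet_iff ends a b c z).2 hz'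
  | true => simpa using hz

/-- **ANTI₁ from a Reimer certificate.**  For a finite multigraph `ends : ι → Sym2 V` and vertices
`a, b, c`: if the points of `L = lSet ends a b c` carry classes `cls`, flip sets `T` and class targets
`tgt` such that (F) every point of a cylinder `Z(x₁,x₂)` of two class-mates lies in the class target
(`R(b,c) = rSet ends a b c` for `true`, `R(c,b) = rSet ends a c b` for `false`) and (D) normalised
cylinder points of different classes never coincide, then `#L ≤ #R(b,c)` — the conclusion of
conjecture ANTI₁ for this instance.  The diagonal `x₁ = x₂` of (F) says that `x △ T x` lies in the
target; the off-diagonal part replaces injectivity. [this work] -/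
theorem card_lSet_le_of_certificate {κ : Type*} [DecidableEq κ] (ends : ι → Sym2 V) (a b c : V)
    (cls : (ι → Bool) → κ) (T : (ι → Bool) → Finset ι) (tgt : κ → Bool)
    (hF : ∀ x₁ ∈ lSet ends a b c, ∀ x₂ ∈ lSet ends a b c, cls x₁ = cls x₂ →
      ∀ z : ι → Bool, (∀ i, i ∉ T x₁ → z i = x₁ i) → (∀ i ∈ T x₂, z i = !x₂ i) →
      z ∈ (if tgt (cls x₁) then rSet ends a b c else rSet ends a c b))
    (hD : ∀ x₁ ∈ lSet ends a b c, ∀ x₂ ∈ lSet ends a b c, ∀ x₃ ∈ lSet ends a b c, ∀ x₄ ∈ lSet ends a b c,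
      cls x₁ = cls x₂ → cls x₃ = cls x₄ → cls x₁ ≠ cls x₃ →
      ∀ z z' : ι → Bool, (∀ i, i ∉ T x₁ → z i = x₁ i) → (∀ i ∈ T x₂, z i = !x₂ i) →
      (∀ i, i ∉ T x₃ → z' i = x₃ i) → (∀ i ∈ T x₄, z' i = !x₄ i) →
      (if tgt (cls x₁) then z else fun i => !z i) ≠ (if tgt (cls x₃) then z' else fun i => !z' i)) :
    (lSet ends a b c).card ≤ (rSet ends a b c).card :=
  ReimerCertificate.card_le_of_certificate _ _ cls T tgt
    (fun x₁ h₁ x₂ h₂ h z hz₁ hz₂ => norm_mem_rSet ends a b c _ (hF x₁ h₁ x₂ h₂ h z hz₁ hz₂)) hD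

end AntipodalR1

end Summit.CriticalPhenomena.PercolationContinuityZ3.Theorems
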